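import Summits.QuantumFields.YangMills.Theorems.MirrorModularBoostsSoftKernelBoostCovarianceBelowThresholdOfSoftKernel
import Summits.QuantumFields.YangMills.Theorems.MirrorModularBoostsSoftKernelBoostCovarianceStepZeroByDegrees
import HarnessLib

/-!
# `NPointIsotropyBelowThreshold` — the crux-strategist's SPLIT into the two Yang–Mills UV inputs
(support for stmt-QuantumFields-15892)

Crux `stmt-QuantumFields-15892` (`CertificationLength.NPointIsotropyBelowThreshold`, route
`route-QuantumFields-CertificationLength`, rank 6): planar rotation invariance on `⁰𝒮` of every `n`-point function of a
one-species family `S₁` tied to a Wilson Yang–Mills scheme (package `W₁`), reflection positive in the eight planar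
frames and carrying the SOFT real two-point kernel `|K x| ≤ C (1 + ‖x‖^(η-10))`, `η > 0`.  Unit
`cstrat-stmt-QuantumFields-15892-b1` (strategy before a lead).

By the landed web (`…BelowThresholdOfSoftKernel`: `softKernelBoostCovariance_iff_belowThreshold`) this crux is the SAME
problem as `MirrorModularBoosts.SoftKernelBoostCovariance` (stmt-QuantumFields-14999), whose terminal line `Sketch` and
the proved engine item `IsotropyFromPowerCounting.EngineFromPowerCounting` (stmt-QuantumFields-17722,
`engineFromPowerCounting_proof`) reduce it — through the landed complex-rotation sieve (planar cone, radial soft kernel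
by KernelTransfer + ShellRigidity, Laurent layers, typed boost vectors, parity sieve) — to exactly two UV statements about
the Wilson limit, both ITEMS of route `IsotropyFromPowerCounting`:

* Step 0 — `IsotropyFromPowerCounting.CurvatureDensities` (stmt-QuantumFields-17723; every `𝔖ₙ|⁰𝒮` is integration
  against a function; a corollary of `TemperedCurvatureMoments`, stmt-QuantumFields-17721, by the landed
  `curvatureDensities_of_temperedCurvatureMoments`), and
* Σ — `IsotropyFromPowerCounting.CurvatureSandwichBound` (stmt-QuantumFields-18372; the transversely filtered
  heat-sandwich operator bound with exponent `μ < 4` in the `e₀` frame and in the `45°` frame).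

This file is the glue of the route-level split `NPointIsotropyBelowThreshold ⇐ CurvatureDensities ∧ CurvatureSandwichBound`
on route CertificationLength, as ONE landed constant per recipe (pure composition of landed theorems, no new mathematics):

* `NPointIsotropyBelowThreshold_of_subs     : CurvatureDensities → CurvatureSandwichBound → NPointIsotropyBelowThreshold`
  (`regularHigh_of_curvatureDensities` p142709, `softKernelBoostCovariance_of_regularHigh_of_sandwich` p142709,
  `stub_belowThresholdOfSoftKernel` p138346);
* `NPointIsotropyBelowThreshold_of_T_sigma  : TemperedCurvatureMoments → CurvatureSandwichBound → NPointIsotropyBelowThreshold`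
  (`engineFromPowerCounting_proof` p138806 then `stub_belowThresholdOfSoftKernel`).

The module imports the fact-laden proof cones of ShellRigidity / KernelTransfer / PlanarSpectralCone ON PURPOSE (prover
side); it must therefore NOT be imported by the route module `Theses.CertificationLength` (cone repair rev 5) — the split's
glue is filed as an ITEM of that route and closed by a three-line Theorems file importing this one.  Design choice: the
children are the EXISTING items 17723 / 18372 verbatim (dedup attaches route CertificationLength to them), not the weaker
row-wise forms of the birth skeleton `Cruxes/NPointIsotropyBelowThreshold/Lines/birth.lean`, so that no duplicate item is
created.  What is deliberately NOT here: any statement about the wild sector itself (that is the content of the two items).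
[folklore]
-/

namespace Summit.QuantumFields.YangMills.Theorems.CertificationLength.NPointIsotropyBelowThresholdSplit

open Summit.QuantumFields.YangMills.Theorems.SoftKernelBoostCovariance.Sketch
  (stub_belowThresholdOfSoftKernel softKernelBoostCovariance_of_regularHigh_of_sandwich
    regularHigh_of_curvatureDensities engineFromPowerCounting_proof)

/-- **`NPointIsotropyBelowThreshold_of_subs` — the split glue.**  Step 0 (`CurvatureDensities`, stmt-QuantumFields-17723)
and the heat-sandwich bound Σ (`CurvatureSandwichBound`, stmt-QuantumFields-18372) imply the crux
`CertificationLength.NPointIsotropyBelowThreshold` (stmt-QuantumFields-15892): restrict Step 0 to the degrees `≥ 3`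
(`regularHigh_of_curvatureDensities`), run the landed by-name closing recipe of crux 14999
(`softKernelBoostCovariance_of_regularHigh_of_sandwich`: `cruxOfInputsK` after `stub_stepZeroByDegrees`, the 45° frame
bridged by `sandwichBound_planeRot_of_curvatureSandwichBound`), and transfer below the threshold
(`stub_belowThresholdOfSoftKernel`: the planar cone is supplied by the closed item stmt-QuantumFields-9664). [folklore] -/
theorem NPointIsotropyBelowThreshold_of_subs
    (hD : Summit.QuantumFields.YangMills.Theses.IsotropyFromPowerCounting.CurvatureDensities)
    (hS : Summit.QuantumFields.YangMills.Theses.IsotropyFromPowerCounting.CurvatureSandwichBound) :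
    Summit.QuantumFields.YangMills.Theses.CertificationLength.NPointIsotropyBelowThreshold :=
  stub_belowThresholdOfSoftKernel
    (softKernelBoostCovariance_of_regularHigh_of_sandwich (regularHigh_of_curvatureDensities hD) hS)

/-- **`NPointIsotropyBelowThreshold_of_T_sigma` — the same through T.**  `TemperedCurvatureMoments`
(stmt-QuantumFields-17721) and Σ (stmt-QuantumFields-18372) imply the crux: the PROVED engine item
`EngineFromPowerCounting` (stmt-QuantumFields-17722, `engineFromPowerCounting_proof : T → Σ → SoftKernelBoostCovariance`)
followed by the below-threshold transfer `stub_belowThresholdOfSoftKernel`.  When `…TemperedCurvatureMoments_holds` and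
`…CurvatureSandwichBound_holds` exist, `NPointIsotropyBelowThreshold_of_T_sigma ‹_› ‹_›` closes stmt-QuantumFields-15892.
[folklore] -/
theorem NPointIsotropyBelowThreshold_of_T_sigma
    (hT : Summit.QuantumFields.YangMills.Theses.IsotropyFromPowerCounting.TemperedCurvatureMoments)
    (hS : Summit.QuantumFields.YangMills.Theses.IsotropyFromPowerCounting.CurvatureSandwichBound) :
    Summit.QuantumFields.YangMills.Theses.CertificationLength.NPointIsotropyBelowThreshold :=
  stub_belowThresholdOfSoftKernel (engineFromPowerCounting_proof hT hS)

/-- **Step 0 is weaker than T** (recorded for the split's bookkeeping): `TemperedCurvatureMoments` (stmt-QuantumFields-17721)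
implies `CurvatureDensities` (stmt-QuantumFields-17723) — the landed `curvatureDensities_of_temperedCurvatureMoments`
(p138806), re-exported under the split's namespace so that the children of the split are, by name, the weakest inputs the
sieve consumes. [folklore] -/
theorem curvatureDensities_of_T
    (hT : Summit.QuantumFields.YangMills.Theses.IsotropyFromPowerCounting.TemperedCurvatureMoments) :
    Summit.QuantumFields.YangMills.Theses.IsotropyFromPowerCounting.CurvatureDensities :=
  Summit.QuantumFields.YangMills.Theorems.SoftKernelBoostCovariance.Sketch.curvatureDensities_of_temperedCurvatureMoments hT

end Summit.QuantumFields.YangMills.Theorems.CertificationLength.NPointIsotropyBelowThresholdSplit
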